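import Summits.AtomisticToContinuum.Crystallization.Theorems.ChargedEnergyGapRowSchema
import Summits.AtomisticToContinuum.Crystallization.Theorems.ChargedEnergyGapFarSourceTail
import HarnessLib

/-!
# Charged energy gap — lens-3 g65, node «BarlowRef» (R3) — part 26d «BandFrame»: a certified row table + cored counts ⟹ `TubeShareBoundH`

Cell `decomp-a2c`, seat lens-3, generation 65.  Imports part 26b (`…RowSchema`) and part 22b (`…FarSourceTail`).  ELEMENTARY·PROVED.
THE FRAME a machine-written band certificate instantiates (part 26e «Bands»): given

* shells `t : ℕ → ℝ` (`t k ≤ t (k+1)` for `k < m`, `t 0 ≤ 0`), a ROW TABLE `gtab : ℕ → ℝ` (antitone up to `m`, `0 ≤ gtab m`) with the row theorems of part 26c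
  «KernelTable» (`hrows`: a source in shell `j` — `t j ≤ dist y c ≤ t (j+1)`, or `t m ≤ dist y c ≤ 400` for the last shell — has
  `row·V ≤ gtab j` against targets `≥ b₀` from the member and `≥ b₀` from the source),
* CORED COUNTS `hC`/`hCT`: sources within `t (k+1)` (resp. `400`) of a member at level `≤ ℓ`, outside `B(x₀, ϱ)`, number `≤ π·CQ (k+1)/V`
  (resp. `≤ π·CQT/V`) — discharged by part 26b `card_mul_le_cap_of_level'` / `card_mul_le_ball` with rational `CQ`,
* the two RATIONAL inequalities `gtab m·CQT + Σ_{k<m} (gtab k − gtab (k+1))·CQ (k+1) ≤ ΛQ` and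
  `ΛQ + (3/50)·(10000/31415) ≤ θ·(4/3·(81/5)³·463/1000)` (`π > 3.1415`; `3/50` is part 22's far allowance `tubeLoad_far·V² ≤ 3/50`;
  `(4π/3)·16.2³ ≤ N_q·V` is part 22b's `exists_finset_closedBall_sameV`; `V ≥ 463/1000`),

★★★ `tubeShareBoundH_of_certificate` concludes `TubeShareBoundH (3/5) (101/5) ϱ ℓ b₀ 18 θ` — the hypothesis shape PART 25's
`bulkFarResidueBoundB_record_of_tubeBlockExhibition` consumes.  The proof: split the sources at distance `400`; far part = part 22b; near part =
part 26b `shell_abel_le` with the shell index `Nat.findGreatest (t · ≤ dist y c) m`; then divide by the block count.  0 sorry; standard axioms.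
-/

noncomputable section

open scoped Classical RealInnerProductSpace
open Literature.MathematicalPhysics.StatisticalMechanics Literature.Geometry.DiscreteGeometry
open Summit.AtomisticToContinuum.Crystallization.Theses.PricedLinkCensus
open Summit.AtomisticToContinuum.Crystallization.Theorems.ChargedEnergyGapNegative

namespace Summit.AtomisticToContinuum.Crystallization.Theorems.ChargedEnergyGapChartDial

section BandFrame

/-- The shell index of a source: the greatest `j ≤ m` with `t j ≤ d` (`t 0 ≤ d`). -/
theorem exists_shell_index (t : ℕ → ℝ) (m : ℕ) {d : ℝ} (h0 : t 0 ≤ d) :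
    ∃ j ≤ m, t j ≤ d ∧ (d < t (j + 1) ∨ j = m) := by
  refine ⟨Nat.findGreatest (fun j => t j ≤ d) m, Nat.findGreatest_le m,
    Nat.findGreatest_spec (P := fun j => t j ≤ d) (Nat.zero_le m) h0, ?_⟩
  rcases Nat.lt_or_ge (Nat.findGreatest (fun j => t j ≤ d) m) m with hlt | hge
  · left
    exact not_le.1 (Nat.findGreatest_is_greatest (P := fun j => t j ≤ d) (Nat.lt_succ_self _) (Nat.succ_le_of_lt hlt))
  · exact Or.inr (le_antisymm (Nat.findGreatest_le m) hge)

/-- `capVol R t ≤ π·C` from the rational inequality `(R − t)²(2R + t)/3 ≤ C`. -/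
theorem capVol_le_pi_mul {R t C : ℝ} (h : (R - t) ^ 2 * (2 * R + t) / 3 ≤ C) : capVol R t ≤ Real.pi * C := by
  unfold capVol
  nlinarith [Real.pi_pos, mul_le_mul_of_nonneg_left h Real.pi_pos.le]

/-- `4π/3·(A + 9/5)³ ≤ π·C` from `4/3·(A + 9/5)³ ≤ C`. -/
theorem ball_le_pi_mul {A C : ℝ} (h : 4 / 3 * (A + 9 / 5) ^ 3 ≤ C) : 4 * Real.pi / 3 * (A + 9 / 5) ^ 3 ≤ Real.pi * C := by
  nlinarith [Real.pi_pos, mul_le_mul_of_nonneg_left h Real.pi_pos.le]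

/-- `TubeShareBoundH` is monotone in the rate. -/
theorem tubeShareBoundH_mono {s r ϱ ℓ b₀ R θ θ' : ℝ} (hθ : θ ≤ θ') (h : TubeShareBoundH s r ϱ ℓ b₀ R θ) :
    TubeShareBoundH s r ϱ ℓ b₀ R θ' := by
  intro P hsep hBar x₀ c q F G hF hG hq hcℓ hFϱ hGb hFG
  exact (h P hsep hBar x₀ c q F G hF hG hq hcℓ hFϱ hGb hFG).trans (mul_le_mul_of_nonneg_right hθ (Nat.cast_nonneg _))

/-- ★★★ THE BAND CERTIFICATE FRAME (see the module docstring). -/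
theorem tubeShareBoundH_of_certificate {ϱ ℓ b₀ θ CQT ΛQ : ℝ} {t gtab CQ : ℕ → ℝ} {m : ℕ}
    (ht : ∀ k < m, t k ≤ t (k + 1)) (ht0 : t 0 ≤ 0) (hgt : ∀ k < m, gtab (k + 1) ≤ gtab k) (hgm : 0 ≤ gtab m)
    (hrows : ∀ {a h : ℝ} {s : ℤ → ℤ} {g : E3 → E3}, (9 / 10 ≤ a ∧ a ≤ 11 / 10) →
      (0 < h ∧ 27 / 50 * a ^ 2 ≤ h ^ 2 ∧ h ^ 2 ≤ 121 / 150 * a ^ 2) → Isometry g →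
      ∀ j ≤ m, ∀ (y c : E3), t j ≤ dist y c → (dist y c ≤ t (j + 1) ∨ j = m) → dist y c ≤ 400 →
      ∀ G : Finset E3, ↑G ⊆ g '' barlowStacking a h s → (∀ z ∈ G, b₀ ≤ dist z c) → (∀ z ∈ G, b₀ ≤ dist y z) →
      (∑ z ∈ G, if y ≠ z ∧ Metric.infDist c (segment ℝ y z) ≤ 101 / 5 then (dist y z)⁻¹ ^ 6 else 0) * (a * (a * √3 / 2) * h) ≤
        gtab j)
    (hC : ∀ {a h : ℝ} {s : ℤ → ℤ} {g : E3 → E3}, (9 / 10 ≤ a ∧ a ≤ 11 / 10) →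
      (0 < h ∧ 27 / 50 * a ^ 2 ≤ h ^ 2 ∧ h ^ 2 ≤ 121 / 150 * a ^ 2) → Isometry g →
      ∀ (x₀ c : E3), dist c x₀ ≤ ℓ → ∀ k < m, ∀ T : Finset E3, ↑T ⊆ g '' barlowStacking a h s →
      (∀ y ∈ T, dist y c ≤ t (k + 1)) → (∀ y ∈ T, ϱ ≤ dist y x₀) → (T.card : ℝ) * (a * (a * √3 / 2) * h) ≤ Real.pi * CQ (k + 1))
    (hCT : ∀ {a h : ℝ} {s : ℤ → ℤ} {g : E3 → E3}, (9 / 10 ≤ a ∧ a ≤ 11 / 10) →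
      (0 < h ∧ 27 / 50 * a ^ 2 ≤ h ^ 2 ∧ h ^ 2 ≤ 121 / 150 * a ^ 2) → Isometry g →
      ∀ (x₀ c : E3), dist c x₀ ≤ ℓ → ∀ T : Finset E3, ↑T ⊆ g '' barlowStacking a h s →
      (∀ y ∈ T, dist y c ≤ 400) → (∀ y ∈ T, ϱ ≤ dist y x₀) → (T.card : ℝ) * (a * (a * √3 / 2) * h) ≤ Real.pi * CQT)
    (hΛ : gtab m * CQT + ∑ k ∈ Finset.range m, (gtab k - gtab (k + 1)) * CQ (k + 1) ≤ ΛQ)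
    (hθ0 : 0 ≤ θ) (hθ : ΛQ + 3 / 50 * (10000 / 31415) ≤ θ * (4 / 3 * (81 / 5) ^ 3 * (463 / 1000))) :
    TubeShareBoundH (3 / 5) (101 / 5) ϱ ℓ b₀ 18 θ := by
  intro P hsep hBar x₀ c q F G hF hG hq hcℓ hFϱ hGb hFG
  obtain ⟨a, h, sq, g, ha, hh, -, hg, hS⟩ := hBar
  rw [hS] at hF hG hq
  set V : ℝ := a * (a * √3 / 2) * h with hV
  have hVl : 463 / 1000 ≤ V := le_window_cell_volume ha hh
  have hV0 : 0 < V := lt_of_lt_of_le (by norm_num) hVl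
  -- split the sources at distance 400 from `c`
  set Fn := F.filter (fun y => dist y c < 400) with hFn
  set Ff := F.filter (fun y => ¬ dist y c < 400) with hFf
  have hFnF : Fn ⊆ F := by rw [hFn]; exact Finset.filter_subset _ F
  have hFnS : (↑Fn : Set E3) ⊆ g '' barlowStacking a h sq := (Finset.coe_subset.2 hFnF).trans hF
  have hFn400 : ∀ y ∈ Fn, dist y c < 400 := fun y hy => by rw [hFn, Finset.mem_filter] at hy; exact hy.2
  have hsplit : tubeLoad (101 / 5) c F G = tubeLoad (101 / 5) c Fn G + tubeLoad (101 / 5) c Ff G := by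
    unfold tubeLoad
    rw [hFn, hFf, Finset.sum_filter_add_sum_filter_not]
  -- the far sources: part 22b
  have hfar : tubeLoad (101 / 5) c Ff G * V ^ 2 ≤ 3 / 50 :=
    tubeLoad_far_record_le ha hh hg c Ff ((Finset.coe_subset.2 (by rw [hFf]; exact Finset.filter_subset _ F)).trans hF)
      (fun y hy => by rw [hFf, Finset.mem_filter, not_lt] at hy; exact hy.2) G hG
  -- the near sources: discrete Abel over the shells
  have hw : ∀ y ∈ Fn, ∃ j ≤ m, (dist y c < t (j + 1) ∨ j = m) ∧
      (∑ z ∈ G, if y ≠ z ∧ Metric.infDist c (segment ℝ y z) ≤ 101 / 5 then (dist y z)⁻¹ ^ 6 else 0) * V ≤ gtab j := by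
    intro y hy
    obtain ⟨j, hjm, hlo, hup⟩ := exists_shell_index t m (ht0.trans (dist_nonneg : 0 ≤ dist y c))
    exact ⟨j, hjm, hup, hrows ha hh hg j hjm y c hlo (hup.imp le_of_lt id) (hFn400 y hy).le G hG hGb
      fun z hz => hFG y (hFnF hy) z hz⟩
  have hN : ∀ k < m, ((Fn.filter fun y => dist y c < t (k + 1)).card : ℝ) ≤ Real.pi * CQ (k + 1) / V := by
    intro k hk
    rw [le_div_iff₀ hV0]
    refine hC ha hh hg x₀ c hcℓ k hk _ ((Finset.coe_subset.2 (Finset.filter_subset _ Fn)).trans hFnS) (fun y hy => ?_) fun y hy => ?_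
    · exact le_of_lt (Finset.mem_filter.1 hy).2
    · exact hFϱ y (hFnF (Finset.mem_filter.1 hy).1)
  have hNT : (Fn.card : ℝ) ≤ Real.pi * CQT / V := by
    rw [le_div_iff₀ hV0]
    exact hCT ha hh hg x₀ c hcℓ Fn hFnS (fun y hy => (hFn400 y hy).le) fun y hy => hFϱ y (hFnF hy)
  have habel := shell_abel_le Fn (fun y => dist y c)
    (fun y => (∑ z ∈ G, if y ≠ z ∧ Metric.infDist c (segment ℝ y z) ≤ 101 / 5 then (dist y z)⁻¹ ^ 6 else 0) * V)
    t gtab (fun k => Real.pi * CQ k / V) m ht hgt hgm hw hN hNT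
  have hnear : tubeLoad (101 / 5) c Fn G * V ^ 2 ≤ Real.pi * ΛQ := by
    have e1 : tubeLoad (101 / 5) c Fn G * V =
        ∑ y ∈ Fn, (∑ z ∈ G, if y ≠ z ∧ Metric.infDist c (segment ℝ y z) ≤ 101 / 5 then (dist y z)⁻¹ ^ 6 else 0) * V := by
      unfold tubeLoad; rw [Finset.sum_mul]
    have e2 : ∑ k ∈ Finset.range m, (gtab k - gtab (k + 1)) * (Real.pi * CQ (k + 1) / V) =
        Real.pi / V * ∑ k ∈ Finset.range m, (gtab k - gtab (k + 1)) * CQ (k + 1) := by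
      rw [Finset.mul_sum]
      exact Finset.sum_congr rfl fun k _ => by ring
    have h3 : tubeLoad (101 / 5) c Fn G * V ≤
        Real.pi / V * (gtab m * CQT + ∑ k ∈ Finset.range m, (gtab k - gtab (k + 1)) * CQ (k + 1)) := by
      rw [e1]
      refine habel.trans_eq ?_
      rw [e2]; ring
    have h4 : Real.pi / V * (gtab m * CQT + ∑ k ∈ Finset.range m, (gtab k - gtab (k + 1)) * CQ (k + 1)) ≤ Real.pi / V * ΛQ :=
      mul_le_mul_of_nonneg_left hΛ (by positivity)
    calc tubeLoad (101 / 5) c Fn G * V ^ 2 = tubeLoad (101 / 5) c Fn G * V * V := by ring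
      _ ≤ Real.pi / V * ΛQ * V := mul_le_mul_of_nonneg_right (h3.trans h4) hV0.le
      _ = Real.pi * ΛQ := by field_simp
  have htot : tubeLoad (101 / 5) c F G * V ^ 2 ≤ Real.pi * ΛQ + 3 / 50 := by
    rw [hsplit, add_mul]; exact add_le_add hnear hfar
  -- the block count
  obtain ⟨T, hT, hvol⟩ := exists_finset_closedBall_sameV ha hh hg hq (R := 18) (by norm_num)
  have hfin := hsep.finite_inter_closedBall (by norm_num : (0 : ℝ) < 3 / 5) q 18
  have hTN : (T.card : ℝ) ≤ ((P.points ∩ Metric.closedBall q 18).ncard : ℝ) := by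
    have hT' : (↑T : Set E3) ⊆ P.points ∩ Metric.closedBall q 18 := by rw [hS]; exact hT
    have h1 := Set.ncard_le_ncard hT' hfin
    rw [Set.ncard_coe_finset] at h1
    exact_mod_cast h1
  have hNq : 4 * Real.pi / 3 * (18 - 9 / 5) ^ 3 ≤ ((P.points ∩ Metric.closedBall q 18).ncard : ℝ) * V :=
    hvol.trans (mul_le_mul_of_nonneg_right hTN hV0.le)
  -- the arithmetic: `π·ΛQ + 3/50 ≤ θ·(4π/3·16.2³)·V`
  have hπ : (3.1415 : ℝ) < Real.pi := Real.pi_gt_d4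
  have hkey : Real.pi * ΛQ + 3 / 50 ≤ θ * (4 * Real.pi / 3 * (18 - 9 / 5) ^ 3) * V := by
    have h1 : (3 : ℝ) / 50 ≤ Real.pi * (3 / 50 * (10000 / 31415)) := by norm_num at hπ ⊢; nlinarith [hπ]
    have h2 := mul_le_mul_of_nonneg_left hθ Real.pi_pos.le
    have h3 : θ * (4 * Real.pi / 3 * (18 - 9 / 5) ^ 3) * (463 / 1000) ≤ θ * (4 * Real.pi / 3 * (18 - 9 / 5) ^ 3) * V :=
      mul_le_mul_of_nonneg_left hVl (by positivity)
    have e : θ * (4 * Real.pi / 3 * (18 - 9 / 5) ^ 3) * (463 / 1000) = Real.pi * (θ * (4 / 3 * (81 / 5) ^ 3 * (463 / 1000))) := by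
      ring
    rw [mul_add] at h2
    linarith
  have h5 : tubeLoad (101 / 5) c F G * V ^ 2 ≤ θ * ((P.points ∩ Metric.closedBall q 18).ncard : ℝ) * V ^ 2 :=
    calc tubeLoad (101 / 5) c F G * V ^ 2 ≤ θ * (4 * Real.pi / 3 * (18 - 9 / 5) ^ 3) * V := htot.trans hkey
      _ ≤ θ * (((P.points ∩ Metric.closedBall q 18).ncard : ℝ) * V) * V :=
          mul_le_mul_of_nonneg_right (mul_le_mul_of_nonneg_left hNq hθ0) hV0.le
      _ = θ * ((P.points ∩ Metric.closedBall q 18).ncard : ℝ) * V ^ 2 := by ring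
  exact le_of_mul_le_mul_right h5 (by positivity)

end BandFrame

end Summit.AtomisticToContinuum.Crystallization.Theorems.ChargedEnergyGapChartDial
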